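import Summits.HodgeConjecture.HodgeConjecture.Theorems.MarkmanPartnerTransportPartnerTransportEndomorphisms
import Summits.HodgeConjecture.HodgeConjecture.Theorems.MarkmanPartnerTransportPartnerTransportTranscendental
import Summits.HodgeConjecture.HodgeConjecture.Theorems.MarkmanPartnerTransportHilbertSquareCycleInducedTransport
import Literature.AlgebraicGeometry.Surfaces.K3RealMultiplicationCycleInduced
import Literature.AlgebraicGeometry.Hyperkaehler.K3HilbertSquareIncidence
import Literature.AlgebraicGeometry.Hyperkaehler.MarkmanRationalHodgeIsometries

/-!
# Route MarkmanPartnerTransport · crux #5 `LowPicardRealMultiplication` (stmt-HodgeConjecture-19653) —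
# «CYCLE DESCENT»: an algebraic self-correspondence of `X` killing `N¹(X)` DESCENDS to a cycle-induced
# transcendental endomorphism of a K3 partner `S`

Cell hodge-nonav, chapter ROUTE-P1AL; planner p1 g40 GO (E) «PARTNERED LOSSLESS IFF» (2026-08-28T18:43Z), file 1∕2
(the sibling of «PARTNER-RM-TYPE» `exists_generator_natDegree_of_partner`, p655614, carrying the transported CYCLE);
prover seat hodge-nonav-20241-p1 (gen 16). `--supports stmt-HodgeConjecture-19653` helper.

For the partner data (marked `(X, φ, P, z)` of `K3^{[2]}` type, marked projective K3 `(S, η, p, x)`, marked Hilbert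
square `(H, φ_H, P_H, (x,0))` of `K3^{[2]}` type with Beauville's algebraic incidence `θ`, `φ_H([θ]_* a) = (η a, 0)`,
O'Grady's class of `H` algebraic, and `g : H²(S) → H²(X)` with (g1), (g2), (g5)) and an endomorphism `t_X` of
`H²(X(ℂ); ℂ)` which is rational, type-preserving, KILLS `N¹(X)`, has `q`-transcendental image and is CYCLE-INDUCED
(`t_X = [Z]_*`, `Z ∈ A⁴(X × X)`):

* **`exists_cycleInduced_descent_of_partner`** — `t_S := π ∘ e⁻¹ ∘ t_X ∘ e ∘ [θ]_*` (`e : H²(H) ⥲ H²(X)` the marked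
  rational Hodge isometry, `π` the Beauville–Bogomolov retraction) is a CYCLE-INDUCED TRANSCENDENTAL ENDOMORPHISM of
  `S` (`IsCycleInducedTranscendentalEndomorphism`: rational, type-preserving, kills `N¹(S)`, image `⊥ N¹(S)`,
  `t_S = [γ]_*` with `γ = Λ ∘ Z_{e⁻¹} ∘ Z ∘ Z_e ∘ θ ∈ A²(S × S)` — FOUR compositions of algebraic correspondences,
  `exists_corrAction_comp`; `Λ` the algebraic Fujiki retraction `exists_algebraicClass_corrAction_eq_retraction`;
  `Z_e, Z_{e⁻¹} ∈ A⁴` by Markman's theorem `Markman2024_rationalHodgeIsometry_algebraic_marked`), acting on the `2`-form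
  `η⁻¹ x` by the eigenvalue of `t_X` on `φ⁻¹ z`;
* `exists_cycleInduced_descent_of_partner_of_facts` — the same with `H` supplied by
  `Beauville1983_hilbertSquare_markedIncidence` and O'Grady's class by `OGrady2008_dualBBFClass_algebraic`.

CONDITIONAL on the displayed named facts {`Voisin2003_cupProduct_algebraicClasses`,
`Markman2024_rationalHodgeIsometry_algebraic_marked` (+ Beauville incidence, O'Grady in `_of_facts`)}; no definition,
no sorry, no new named fact; credits nothing to HC. (Imports `…HilbertSquareCycleInducedTransport`, which sits in the
route's theses cone — the composition calculus and the retraction live there.)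

References: E. Markman, Compos. Math. 160 (2024) §1.1 Thm. 1.1; A. Beauville, J. Differential Geom. 18 (1983) §6 Prop. 6,
§9 Lemme 1; K. O'Grady, Commun. Contemp. Math. 10 (2008) §3; W. Fulton, *Intersection Theory* §16.1 Prop. 16.1.1;
B. van Geemen, M. Schütt, Forum Math. Sigma 13 (2025) e2, §4.8.
-/

noncomputable section

set_option linter.dupNamespace false

open scoped Matrix
open Module CategoryTheory MonoidalCategory Polynomial
open Literature.AlgebraicTopology.SingularHomology Literature.Geometry.Kaehler
open Literature.AlgebraicGeometry Literature.AlgebraicGeometry.Motives Literature.AlgebraicGeometry.HodgeTheory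
open Literature.AlgebraicGeometry.Hyperkaehler Literature.AlgebraicGeometry.Surfaces
open Summit.HodgeConjecture.HodgeConjecture.Theorems.NikulinTwinTransport
open Summit.HodgeConjecture.HodgeConjecture.Theorems.MarkmanPartnerTransport.BBFPositivity

namespace Summit.HodgeConjecture.HodgeConjecture.Theorems.MarkmanPartnerTransport.PartnerLattice

/-- `MarkedK3Sq[X, φ, P, z]`: VERBATIM the `let MarkedK3Sq := …` binder of the route declarations of
MarkmanPartnerTransport (clauses (m1)–(m6)). Local notation only. -/
local notation3 (prettyPrint := false) "MarkedK3Sq[" X ", " φ ", " P ", " z "]" =>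
  (((IsIntegralClass P ∧ ∀ Q : complexBetti X (2 * 4), IsIntegralClass Q → ∃ n : ℤ, Q = n • P) ∧
    (∀ c : complexBetti X 2, IsIntegralClass c ↔ ∃ v : K3HilbertIndex → ℤ, φ c = fun i => (v i : ℂ)) ∧
    (∀ a : complexBetti X 2, cupPowTwo a 4 = ((3 : ℂ) * (k3HilbertForm 2 (φ a) (φ a)) ^ 2) • P) ∧
    (IsOfHodgeType 4 X 2 2 0 (LinearEquiv.symm φ z) ∧
      ∀ τ : complexBetti X 2, IsOfHodgeType 4 X 2 2 0 τ → ∃ t : ℂ, τ = t • LinearEquiv.symm φ z) ∧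
    (∀ c : complexBetti X 2, IsOfHodgeType 4 X 2 1 1 c ↔
      (k3HilbertForm 2 (φ c) z = 0 ∧ k3HilbertForm 2 (φ c) (star z) = 0)) ∧
    (k3HilbertForm 2 z z = 0 ∧ 0 < (k3HilbertForm 2 (star z) z).re)))

/-- `MarkedK3[S, η, p, x]`: the six K3 marking clauses, VERBATIM those of
`Beauville1983_hilbertSquare_markedIncidence`. Local notation only. [cite: Huybrechts2016K3, Ch. 1 Prop. 3.5] -/
local notation3 (prettyPrint := false) "MarkedK3[" S ", " η ", " p ", " x "]" =>
  (IsIntegralClass p ∧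
    (∀ q : complexBetti S (2 * 2), IsIntegralClass q → ∃ n : ℤ, q = n • p) ∧
    (∀ c : complexBetti S (2 * 1), IsIntegralClass c ↔ ∃ v : K3Index → ℤ, η c = fun i => (v i : ℂ)) ∧
    (∀ a b : complexBetti S (2 * 1),
        cupProduct (rfl : 2 * 1 + 2 * 1 = 2 * 2) a b = k3Form (η a) (η b) • p) ∧
    IsOfHodgeType 2 S (2 * 1) 2 0 (LinearEquiv.symm η x) ∧
    (∀ τ : complexBetti S (2 * 1), IsOfHodgeType 2 S (2 * 1) 2 0 τ → ∃ t : ℂ, τ = t • LinearEquiv.symm η x))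

variable {X S H : SchemeOver ℂ} {φ : complexBetti X 2 ≃ₗ[ℂ] (K3HilbertIndex → ℂ)} {P : complexBetti X (2 * 4)}
  {z : K3HilbertIndex → ℂ} {η : complexBetti S (2 * 1) ≃ₗ[ℂ] (K3Index → ℂ)} {p : complexBetti S (2 * 2)}
  {x : K3Index → ℂ} {φH : complexBetti H 2 ≃ₗ[ℂ] (K3HilbertIndex → ℂ)} {PH : complexBetti H (2 * 4)}

/-- **«CYCLE DESCENT» along a K3 partner** (module docstring): an admissible, cycle-induced endomorphism `t_X` of
`H²(X)` (rational, type-preserving, killing `N¹(X)`, `q`-transcendental image, `t_X = [Z]_*`) descends to the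
cycle-induced transcendental endomorphism `t_S = π ∘ e⁻¹ ∘ t_X ∘ e ∘ [θ]_*` of the partner `S`, with the same
eigenvalue on the `2`-form. [cite: Markman2024, §1.1 Thm. 1.1] [cite: Beauville1983, §6 Prop. 6 and §9 Lemme 1]
[cite: OGrady2008NumericalK3Square, §3 Claim 3.1] [cite: Fulton1998, §16.1 Prop. 16.1.1] -/
theorem exists_cycleInduced_descent_of_partner
    (hcup : Voisin2003_cupProduct_algebraicClasses) (hMkI : Markman2024_rationalHodgeIsometry_algebraic_marked)
    (hX : IsSmoothProjective 4 X) (hK : IsOfK3HilbertSquareType X) (hM : MarkedK3Sq[X, φ, P, z])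
    (hS : IsK3Surface S) (hp0 : p ≠ 0)
    (hηint : ∀ c : complexBetti S (2 * 1), IsIntegralClass c ↔ ∃ v : K3Index → ℤ, η c = fun i => (v i : ℂ))
    (hcupS : ∀ a b : complexBetti S (2 * 1),
      cupProduct (rfl : 2 * 1 + 2 * 1 = 2 * 2) a b = k3Form (η a) (η b) • p)
    (h20 : IsOfHodgeType 2 S (2 * 1) 2 0 (η.symm x))
    (h20span : ∀ τ : complexBetti S (2 * 1), IsOfHodgeType 2 S (2 * 1) 2 0 τ → ∃ t : ℂ, τ = t • η.symm x)
    (hxpos : 0 < (k3Form (star x) x).re)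
    (hH : IsSmoothProjective 4 H) (hKH : IsOfK3HilbertSquareType H) (hMH : MarkedK3Sq[H, φH, PH, Sum.elim x 0])
    (hqd : dualBBFClass 2 φH ∈ algebraicClasses H 2)
    {θ : complexBetti (H ⊗ S) (2 * 2)} (hθ : θ ∈ algebraicClasses (H ⊗ S) 2)
    (hi : ∀ a : complexBetti S (2 * 1),
      φH (corrAction complexOrientationFamily hH (IsK3Surface.isSmoothProjective hS)
        (rfl : 2 * 1 + 2 * 2 = 2 + 2 * 2) θ a) = Sum.elim (η a) 0)
    {g : complexBetti S (2 * 1) →ₗ[ℂ] complexBetti X 2}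
    (hg1 : ∀ a, IsRationalClass a → IsRationalClass (g a))
    (hg2 : ∀ (i j : ℕ) a, IsOfHodgeType 2 S (2 * 1) i j a → IsOfHodgeType 4 X 2 i j (g a))
    (hg5 : ∀ a b, (∀ d ∈ algebraicClasses S 1, cupProduct (rfl : 2 * 1 + 2 * 1 = 2 * 2) a d = 0) →
      (∀ d ∈ algebraicClasses S 1, cupProduct (rfl : 2 * 1 + 2 * 1 = 2 * 2) b d = 0) →
      k3HilbertForm 2 (φ (g a)) (φ (g b)) = k3Form (η a) (η b))
    (tX : complexBetti X 2 →ₗ[ℂ] complexBetti X 2)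
    (ht1 : ∀ y, IsRationalClass y → IsRationalClass (tX y))
    (ht2 : ∀ (i j : ℕ) y, IsOfHodgeType 4 X 2 i j y → IsOfHodgeType 4 X 2 i j (tX y))
    (ht3 : ∀ d : complexBetti X 2, d ∈ algebraicClasses X 1 → tX d = 0)
    (ht4 : ∀ y : complexBetti X 2, ∀ d : complexBetti X 2, d ∈ algebraicClasses X 1 →
      k3HilbertForm 2 (φ (tX y)) (φ d) = 0)
    (htZ : ∃ Z ∈ algebraicClasses (X ⊗ X) 4, ∀ y : complexBetti X 2,
      tX y = corrAction complexOrientationFamily hX hX (rfl : 2 + 2 * 4 = 2 + 2 * 4) Z y)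
    {ev : ℂ} (htev : tX (LinearEquiv.symm φ z) = ev • LinearEquiv.symm φ z) :
    ∃ tS : complexBetti S (2 * 1) →ₗ[ℂ] complexBetti S (2 * 1),
      IsCycleInducedTranscendentalEndomorphism S (IsK3Surface.isSmoothProjective hS) tS ∧
      tS (LinearEquiv.symm η x) = ev • LinearEquiv.symm η x := by
  classical
  obtain ⟨-, hint, -, ⟨hz20, hz20span⟩, -⟩ := id hM
  obtain ⟨-, hintH, -⟩ := id hMH
  have hS2 : IsSmoothProjective 2 S := IsK3Surface.isSmoothProjective hS
  have hμ : complexOrientationFamily.HasPoincareDuality := hasPoincareDuality_complexOrientationFamily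
  have hMK : IsMarkedK3Hilb 2 H φH PH := isMarkedK3Hilb_of_marked hMH
  have hPH : PH ≠ 0 := generator_ne_zero_of_markedSq hH hMH
  -- the marked rational Hodge isometry `e : H²(H) ⥲ H²(X)` and its inverse
  obtain ⟨f, hfbij, hfrat, hfh, hfq⟩ := exists_markedHodgeIsometry_of_partner hcup hμ hX hM hS hηint hcupS
    h20 hxpos hH hMH hθ hi hg1 hg2 hg5
  obtain ⟨e, he, herat, heh, hseq⟩ := exists_inverse_markedHodgeIsometry hH hX hMH hM hfbij hfrat hfh hfq
  have herat' : ∀ c, IsRationalClass c → IsRationalClass (e c) := fun c hc => by rw [he]; exact hfrat c hc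
  have heh' : ∀ (i j : ℕ) c, IsOfHodgeType 4 H 2 i j c → IsOfHodgeType 4 X 2 i j (e c) :=
    fun i j c hc => by rw [he]; exact hfh i j c hc
  have heq : ∀ a b, k3HilbertForm 2 (φ (e a)) (φ (e b)) = k3HilbertForm 2 (φH a) (φH b) :=
    fun a b => by rw [he, he]; exact hfq a b
  have hebij : Function.Bijective (e : complexBetti H 2 →ₗ[ℂ] complexBetti X 2) := e.bijective
  have hesbij : Function.Bijective (e.symm : complexBetti X 2 →ₗ[ℂ] complexBetti H 2) := e.symm.bijective
  -- Markman: `e = [Z_e]_*`, `e⁻¹ = [Z_e']_*`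
  obtain ⟨Ze, hZe, hZe_eq⟩ := hMkI complexOrientationFamily hμ H X hH hX hKH hK φH PH (Sum.elim x 0) φ P z hMH hM
    (e : complexBetti H 2 →ₗ[ℂ] complexBetti X 2) hebij (fun c hc => herat' c hc) (fun i j c hc => heh' i j c hc)
    (fun a b => heq a b)
  obtain ⟨Ze', hZe', hZe'_eq⟩ := hMkI complexOrientationFamily hμ X H hX hH hK hKH φ P z φH PH (Sum.elim x 0) hM hMH
    (e.symm : complexBetti X 2 →ₗ[ℂ] complexBetti H 2) hesbij (fun c hc => herat c hc) (fun i j c hc => heh i j c hc)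
    (fun a b => hseq a b)
  -- `e(N¹(H)) ⊆ N¹(X)`, `e⁻¹(N¹(X)) ⊆ N¹(H)`
  have heN : ∀ d ∈ algebraicClasses H 1, e d ∈ algebraicClasses X 1 := fun d hd =>
    map_mem_algebraicClasses_of_isRationalClass_of_oneOne hH hX (e : complexBetti H 2 →ₗ[ℂ] complexBetti X 2)
      herat' (heh' 1 1) hd
  -- `i` and `π`
  set i : complexBetti S (2 * 1) →ₗ[ℂ] complexBetti H 2 :=
    corrAction complexOrientationFamily hH hS2 (rfl : 2 * 1 + 2 * 2 = 2 + 2 * 2) θ with hidef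
  have hi' : ∀ a, φH (i a) = Sum.elim (η a) 0 := hi
  set π : complexBetti H 2 →ₗ[ℂ] complexBetti S (2 * 1) :=
    (η.symm : (K3Index → ℂ) →ₗ[ℂ] complexBetti S (2 * 1)) ∘ₗ
      LinearMap.funLeft ℂ ℂ (Sum.inl : K3Index → K3HilbertIndex) ∘ₗ
      (φH : complexBetti H 2 →ₗ[ℂ] (K3HilbertIndex → ℂ)) with hπdef
  have hπ : ∀ w, π w = η.symm (fun k => φH w (Sum.inl k)) := fun w => rfl
  -- `[θ]_* N¹(S) ⊆ N¹(H)`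
  have hiN : ∀ d ∈ algebraicClasses S 1, i d ∈ algebraicClasses H 1 := fun d hd =>
    corrAction_mem_algebraicClasses_of_cupProductFact hcup hμ hH hS2 (q := 1) rfl (by norm_num) hθ hd
  -- `e⁻¹` carries `q`-transcendental classes of `X` to `q`-transcendental classes of `H`
  have hsymmT : ∀ y : complexBetti X 2, (∀ d ∈ algebraicClasses X 1, k3HilbertForm 2 (φ y) (φ d) = 0) →
      ∀ d ∈ algebraicClasses H 1, k3HilbertForm 2 (φH (e.symm y)) (φH d) = 0 := fun y hy =>
    bbfTransc_map_of_markedHodgeIsometry hX hH e.symm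
      (fun c hc => by rw [LinearEquiv.symm_symm]; exact herat' c hc)
      (fun c hc => by rw [LinearEquiv.symm_symm]; exact heh' 1 1 c hc) hseq hy
  -- the descended endomorphism `t_S = π ∘ e⁻¹ ∘ t_X ∘ e ∘ i`
  set tS : complexBetti S (2 * 1) →ₗ[ℂ] complexBetti S (2 * 1) :=
    π ∘ₗ (e.symm : complexBetti X 2 →ₗ[ℂ] complexBetti H 2) ∘ₗ tX ∘ₗ
      (e : complexBetti H 2 →ₗ[ℂ] complexBetti X 2) ∘ₗ i with htSdef
  have htS : ∀ c, tS c = π (e.symm (tX (e (i c)))) := fun c => rfl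
  -- rational
  have h1 : ∀ c, IsRationalClass c → IsRationalClass (tS c) := by
    intro c hc
    rw [htS, hπ]
    exact isRationalClass_retraction hS hH hηint hintH
      (herat _ (ht1 _ (herat' _ (isRationalClass_incidence hS hH hηint hintH hi' hc))))
  -- Hodge types `(2,0)` and `(1,1)` through the chain, `(0,2)` by conjugation
  have h20S : ∀ c, IsOfHodgeType 2 S (2 * 1) 2 0 c → IsOfHodgeType 2 S (2 * 1) 2 0 (tS c) := by
    intro c hc
    rw [htS, hπ]
    exact retraction_twoZero hMH h20
      (heh 2 0 _ (ht2 2 0 _ (heh' 2 0 _ (incidence_twoZero hMH h20span hi' hc))))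
  have h11S : ∀ c, IsOfHodgeType 2 S (2 * 1) 1 1 c → IsOfHodgeType 2 S (2 * 1) 1 1 (tS c) := by
    intro c hc
    rw [htS, hπ]
    exact retraction_oneOne hS hp0 hηint hcupS h20 hxpos hMH
      (heh 1 1 _ (ht2 1 1 _ (heh' 1 1 _ (incidence_oneOne hS hp0 hηint hcupS h20 hxpos hMH hi' hc))))
  have hconj : ∀ c, tS (conjClass (ComplexPoints S) (2 * 1) c) = conjClass (ComplexPoints S) (2 * 1) (tS c) :=
    fun c => (conjClass_apply_of_isRationalClass η hηint tS h1 c).symm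
  have h2 : ∀ (a b : ℕ) c, IsOfHodgeType 2 S (2 * 1) a b c → IsOfHodgeType 2 S (2 * 1) a b (tS c) := by
    intro a b c hc
    by_cases hab : a + b = 2 * 1
    · have ha2 : a ≤ 2 := by omega
      interval_cases a
      · have hb : b = 2 := by omega
        subst hb
        rw [← conjClass_conjClass (tS c), ← hconj]
        exact (h20S _ (hc.conjClass hS2)).conjClass hS2
      · have hb : b = 1 := by omega
        subst hb
        exact h11S c hc
      · have hb : b = 0 := by omega
        subst hb
        exact h20S c hc
    · have hc0 : c = 0 := by
        obtain ⟨A, hA⟩ := hc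
        rw [(A.hodgePQ_eq_bot_iff (2 * 1) a b).2
            (Literature.NumberTheory.Transcendental.hodgePQ_eq_bot_of_ne (M := A.carrier) hab),
          Submodule.mem_bot] at hA
        exact A.pullback_injective (2 * 1) (by rw [hA, map_zero])
      rw [hc0, map_zero]
      exact isOfHodgeType_zero_of_isSmoothProjective nonempty_hodgeModel_holds hS2 (2 * 1) a b
  -- kills `N¹(S)`
  have h3 : ∀ d ∈ algebraicClasses S 1, tS d = 0 := fun d hd => by
    rw [htS, ht3 _ (heN _ (hiN d hd)), map_zero, map_zero]
  -- image cup-orthogonal to `N¹(S)`, and `e (i (t_S c)) = t_X (e (i c))`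
  have hstep : ∀ c : complexBetti S (2 * 1),
      tX (e (i c)) = e (i (tS c)) ∧
        ∀ d ∈ algebraicClasses S 1, cupProduct (rfl : 2 * 1 + 2 * 1 = 2 * 2) (tS c) d = 0 := by
    intro c
    have hw : ∀ d ∈ algebraicClasses H 1, k3HilbertForm 2 (φH (e.symm (tX (e (i c))))) (φH d) = 0 :=
      hsymmT _ (ht4 _)
    obtain ⟨hπwT, hiπw⟩ := exists_incidence_eq_of_bbfTransc hcup hμ hS hcupS hH hMH hθ hi hw
    rw [← hidef, ← hπ] at hiπw
    rw [← hπ] at hπwT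
    refine ⟨?_, by rw [htS]; exact hπwT⟩
    rw [htS, hiπw, LinearEquiv.apply_symm_apply]
  have h4 : ∀ c : complexBetti S (2 * 1), ∀ d ∈ algebraicClasses S 1,
      cupProduct (rfl : 2 * 1 + 2 * 1 = 2 * 2) (tS c) d = 0 := fun c => (hstep c).2
  -- the eigenvalue on the `2`-form
  have heiσ20 : IsOfHodgeType 4 X 2 2 0 (e (i (η.symm x))) := heh' 2 0 _ (incidence_twoZero hMH h20span hi' h20)
  have hev : tS (η.symm x) = ev • η.symm x := by
    obtain ⟨c, hc⟩ := hz20span _ heiσ20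
    have h1' : tX (e (i (η.symm x))) = ev • e (i (η.symm x)) := by
      rw [hc, map_smul, htev, smul_comm]
    rw [htS, h1', map_smul, LinearEquiv.symm_apply_apply, map_smul, hπ, retraction_incidence hi']
  -- the CYCLE: `γ = Λ ∘ Z_e' ∘ Z ∘ Z_e ∘ θ`
  obtain ⟨Λ, hΛ, hΛπ⟩ := exists_algebraicClass_corrAction_eq_retraction hS2 hH hcupS hMK hPH hqd hθ hi
  obtain ⟨Z, hZ, hZt⟩ := htZ
  obtain ⟨γ₁, hγ₁, hγ₁_eq⟩ := exists_corrAction_comp hX hH hS2 (e := 4) (e' := 2) (e'' := 2) (a := 2 * 1)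
    (a₁ := 2) (a₂ := 2) (rfl : 2 * 1 + 2 * 2 = 2 + 2 * 2) (rfl : 2 + 2 * 4 = 2 + 2 * 4)
    (rfl : 4 + 2 = 2 + 4) (rfl : 2 * 1 + 2 * 2 = 2 + 2 * 2) hZe hθ
  obtain ⟨γ₂, hγ₂, hγ₂_eq⟩ := exists_corrAction_comp hX hX hS2 (e := 4) (e' := 2) (e'' := 2) (a := 2 * 1)
    (a₁ := 2) (a₂ := 2) (rfl : 2 * 1 + 2 * 2 = 2 + 2 * 2) (rfl : 2 + 2 * 4 = 2 + 2 * 4)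
    (rfl : 4 + 2 = 2 + 4) (rfl : 2 * 1 + 2 * 2 = 2 + 2 * 2) hZ hγ₁
  obtain ⟨γ₃, hγ₃, hγ₃_eq⟩ := exists_corrAction_comp hH hX hS2 (e := 4) (e' := 2) (e'' := 2) (a := 2 * 1)
    (a₁ := 2) (a₂ := 2) (rfl : 2 * 1 + 2 * 2 = 2 + 2 * 2) (rfl : 2 + 2 * 4 = 2 + 2 * 4)
    (rfl : 4 + 2 = 2 + 4) (rfl : 2 * 1 + 2 * 2 = 2 + 2 * 2) hZe' hγ₂
  obtain ⟨γ, hγ, hγ_eq⟩ := exists_corrAction_comp hS2 hH hS2 (e := 4) (e' := 2) (e'' := 2) (a := 2 * 1)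
    (a₁ := 2) (a₂ := 2 * 1) (rfl : 2 * 1 + 2 * 2 = 2 + 2 * 2) (rfl : 2 + 2 * 4 = 2 * 1 + 2 * 4)
    (rfl : 4 + 2 = 2 + 4) (rfl : 2 * 1 + 2 * 2 = 2 * 1 + 2 * 2) hΛ hγ₃
  have hcyc : ∀ y : complexBetti S (2 * 1),
      tS y = corrAction complexOrientationFamily hS2 hS2 (rfl : 2 * 1 + 2 * 2 = 2 * 1 + 2 * 2) γ y := by
    intro y
    rw [hγ_eq, hγ₃_eq, hγ₂_eq, hγ₁_eq, ← hidef, ← hZe_eq, ← hZt, ← hZe'_eq, hΛπ, htS, hπ]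
    rfl
  refine ⟨tS, ⟨h1, h2, h3, h4, γ, hγ, fun y => ?_⟩, hev⟩
  rw [hcyc y, corrAction_apply]

/-- **«CYCLE DESCENT» from the named facts**: the same along every K3 partner `(S, η, p, x, g)` of the route's
`IsK3Partner` shape ((g1), (g2), (g5) used), the marked Hilbert square being supplied by
`Beauville1983_hilbertSquare_markedIncidence` and O'Grady's class by `OGrady2008_dualBBFClass_algebraic`.
[cite: Beauville1983, §6 Prop. 6 and Remarque] [cite: Markman2024, §1.1 Thm. 1.1] [cite: OGrady2008NumericalK3Square, §3] -/
theorem exists_cycleInduced_descent_of_partner_of_facts (hBI : Beauville1983_hilbertSquare_markedIncidence)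
    (hO : OGrady2008_dualBBFClass_algebraic) (hcup : Voisin2003_cupProduct_algebraicClasses)
    (hMkI : Markman2024_rationalHodgeIsometry_algebraic_marked)
    (hX : IsSmoothProjective 4 X) (hK : IsOfK3HilbertSquareType X) (hM : MarkedK3Sq[X, φ, P, z])
    (hS : IsK3Surface S) (hp0 : p ≠ 0) (hmk : MarkedK3[S, η, p, x]) (hx0 : k3Form x x = 0)
    (hxpos : 0 < (k3Form (star x) x).re)
    (hproj : ∃ u : K3Index → ℤ, k3Form (fun i => (u i : ℂ)) x = 0 ∧ 0 < ∑ i, ∑ j, u i * k3Gram i j * u j)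
    {g : complexBetti S (2 * 1) →ₗ[ℂ] complexBetti X 2}
    (hg1 : ∀ a, IsRationalClass a → IsRationalClass (g a))
    (hg2 : ∀ (i j : ℕ) a, IsOfHodgeType 2 S (2 * 1) i j a → IsOfHodgeType 4 X 2 i j (g a))
    (hg5 : ∀ a b, (∀ d ∈ algebraicClasses S 1, cupProduct (rfl : 2 * 1 + 2 * 1 = 2 * 2) a d = 0) →
      (∀ d ∈ algebraicClasses S 1, cupProduct (rfl : 2 * 1 + 2 * 1 = 2 * 2) b d = 0) →
      k3HilbertForm 2 (φ (g a)) (φ (g b)) = k3Form (η a) (η b))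
    (tX : complexBetti X 2 →ₗ[ℂ] complexBetti X 2)
    (ht1 : ∀ y, IsRationalClass y → IsRationalClass (tX y))
    (ht2 : ∀ (i j : ℕ) y, IsOfHodgeType 4 X 2 i j y → IsOfHodgeType 4 X 2 i j (tX y))
    (ht3 : ∀ d : complexBetti X 2, d ∈ algebraicClasses X 1 → tX d = 0)
    (ht4 : ∀ y : complexBetti X 2, ∀ d : complexBetti X 2, d ∈ algebraicClasses X 1 →
      k3HilbertForm 2 (φ (tX y)) (φ d) = 0)
    (htZ : ∃ Z ∈ algebraicClasses (X ⊗ X) 4, ∀ y : complexBetti X 2,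
      tX y = corrAction complexOrientationFamily hX hX (rfl : 2 + 2 * 4 = 2 + 2 * 4) Z y)
    {ev : ℂ} (htev : tX (LinearEquiv.symm φ z) = ev • LinearEquiv.symm φ z) :
    ∃ tS : complexBetti S (2 * 1) →ₗ[ℂ] complexBetti S (2 * 1),
      IsCycleInducedTranscendentalEndomorphism S (IsK3Surface.isSmoothProjective hS) tS ∧
      tS (LinearEquiv.symm η x) = ev • LinearEquiv.symm η x := by
  obtain ⟨H, hH, Ξ, φH, PH, -, hKH, hMH, θ, hθ, hi⟩ :=
    hBI complexOrientationFamily hasPoincareDuality_complexOrientationFamily S hS η p x hmk hx0 hxpos hproj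
  obtain ⟨-, -, hηint, hcupS, h20, h20span⟩ := hmk
  have hqd : dualBBFClass 2 φH ∈ algebraicClasses H 2 := (hO H hH hKH φH PH (isMarkedK3Hilb_of_marked hMH)).1
  exact exists_cycleInduced_descent_of_partner hcup hMkI hX hK hM hS hp0 hηint hcupS h20 h20span hxpos hH hKH hMH
    hqd hθ hi hg1 hg2 hg5 tX ht1 ht2 ht3 ht4 htZ htev

end Summit.HodgeConjecture.HodgeConjecture.Theorems.MarkmanPartnerTransport.PartnerLattice

end
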